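import Mathlib
import Summits.ValiantsHypothesis.ValiantsHypothesis.Theorems.TwoProducts.Negative.TowerPaddingR10
import HarnessLib

/-!
# NEGATIVE lane (val-neg-1 g5): `ResidualLawV22 ⇔ PlanarCellBound` (text of the v22 candidate, `ClassCover`/`HasDatum` unfolded)

Helper file for crux `stmt-ValiantsHypothesis-5906` (filed `--supports`; closes NO item, proves NO summit statement, does NOT prove
`TwoProducts`, `PlanarCellBound`, `ResidualLawV21`, `ResidualLawV22`, `ConfinedTameLaw` or VP ≠ VNP; 0 `def`s).

`relation_ladder` v22 (candidate `lmr/staged/p3g16-v22/relation_ladder_v22_candidate.lean` l.1333–1347, pen val-port-1, bytes p3 g16) types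
`stub_residual : ResidualLawV22 := ∃ C a b, hyps(v21′) → ¬(∃ L, #L ≤ C·m ∧ R10Defs.LetterConfined A L ∧ R10Defs.FibreSpread A L ((m+2)^C)) → cell
bound`.  This file: that text (with the line-local abbreviations `ClassCover`, `HasDatum` unfolded token-for-token, `R10Defs.*` BY NAME) is EQUIVALENT
to `PlanarCellBound` as a law — for each `C` by `TowerPaddingR10.residualNotTameR10_iff_planarCellBound` (p658893), and `∃ C` changes nothing.
Label of record for v22: «residual ⇔ PlanarCellBound» (RULING #300), now with R10 inside.  [folklore]
-/

namespace Summit.ValiantsHypothesis.Theorems.TwoProducts.Negative.ResidualV22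

open Finset MvPolynomial
open Summit.ValiantsHypothesis.ValiantsHypothesis.Theorems.NewtonUnitEquations.TwoProducts.FormalLogLinearisation
open Summit.ValiantsHypothesis.ValiantsHypothesis.Theorems.NewtonUnitEquations.TwoProducts.PlanarCell
open Summit.ValiantsHypothesis.ValiantsHypothesis.Theorems.NewtonUnitEquations.TwoProducts.PermutationType
open Summit.ValiantsHypothesis.Theorems.TwoProducts.Negative.TowerPaddingR10

/-- **`ResidualLawV22` (text) ⇒ `PlanarCellBound`.** [folklore] -/
theorem planarCellBound_of_residualV22
    (h : ∃ C a b : ℕ, ∀ (m t : ℕ), 2 ≤ t → ∀ (u v : Fin m → MvPolynomial (Fin 2) ℂ),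
      (∀ j, coeff 0 (u j) = 0 ∧ (u j).support.card ≤ t) → (∀ j, coeff 0 (v j) = 0 ∧ (v j).support.card ≤ t) →
      (∀ (J : Finset (Fin m)) (j₀ : Fin m), j₀ ∈ J →
        BlockSmall (fun j => (u j).support ∪ (v j).support) J (2 ^ m * (t + 2) ^ 4) →
        ¬ PermType (mergeA (fun j => (u j).support ∪ (v j).support) J j₀)) →
      (∀ (r : ℕ) (Jc : Fin r → Finset (Fin m)) (ac bc : Fin r → Fin m → Expo),
        (∀ a ∈ tuples (fun j => (u j).support ∪ (v j).support), ∀ b ∈ tuples (fun j => (u j).support ∪ (v j).support),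
          a ≠ b → ∑ j, a j = ∑ j, b j →
          ∃ k : Fin r, (∀ j, a j ≠ b j ↔ j ∈ Jc k) ∧
            ((∀ j ∈ Jc k, a j = ac k j ∧ b j = bc k j) ∨ (∀ j ∈ Jc k, a j = bc k j ∧ b j = ac k j))) →
        2 ^ m * (t + 2) ^ 4 < 2 * (m + 1) * (3 * (2 + m + m.choose 2) ^ 2) ^ r) →
      (¬ ∃ ρp ρm : Expo →₀ ℕ, RankOneCoincidences (fun j => (u j).support ∪ (v j).support) ρp ρm) →
      (¬ ∃ L : Finset Expo, L.card ≤ C * m ∧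
          R10Defs.LetterConfined (fun j => (u j).support ∪ (v j).support) L ∧
          R10Defs.FibreSpread (fun j => (u j).support ∪ (v j).support) L ((m + 2) ^ C)) →
      ∀ (R : Expo → Expo → Prop) (S : Finset Expo), IsCellFamily u v R S → S.card ≤ 2 ^ (a * m) * (t + 2) ^ b) :
    ∃ a b : ℕ, ∀ (m t : ℕ), 2 ≤ t → ∀ (u v : Fin m → MvPolynomial (Fin 2) ℂ),
      (∀ j, coeff 0 (u j) = 0 ∧ (u j).support.card ≤ t) → (∀ j, coeff 0 (v j) = 0 ∧ (v j).support.card ≤ t) →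
      ∀ (R : Expo → Expo → Prop) (S : Finset Expo),
        (∀ l ∈ S, ∃ ξ : Fin 2 → ℝ, ValidWeight u v ξ ∧ IsStrictTop ξ (logSupport u v) l ∧
          ∀ e ∈ ((Finset.univ.biUnion fun j => (u j).support) ∪ Finset.univ.biUnion fun j => (v j).support),
          ∀ e' ∈ ((Finset.univ.biUnion fun j => (u j).support) ∪ Finset.univ.biUnion fun j => (v j).support),
            (R e e' ↔ wt ξ e ≤ wt ξ e')) →
        S.card ≤ 2 ^ (a * m) * (t + 2) ^ b := by
  obtain ⟨C, a, b, h⟩ := h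
  exact planarCellBound_of_residualNotTameR10 C ⟨a, b, fun m t ht u v hu hv h5 h1 hnd hno R S hS =>
    h m t ht u v hu hv h5 h1 hnd (fun ⟨L, hL, hc, hf⟩ => hno L hL hc hf) R S hS⟩

/-- **`ResidualLawV22` (text) ⇔ `PlanarCellBound`** as laws. [folklore] -/
theorem residualV22_iff_planarCellBound :
    (∃ C a b : ℕ, ∀ (m t : ℕ), 2 ≤ t → ∀ (u v : Fin m → MvPolynomial (Fin 2) ℂ),
      (∀ j, coeff 0 (u j) = 0 ∧ (u j).support.card ≤ t) → (∀ j, coeff 0 (v j) = 0 ∧ (v j).support.card ≤ t) →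
      (∀ (J : Finset (Fin m)) (j₀ : Fin m), j₀ ∈ J →
        BlockSmall (fun j => (u j).support ∪ (v j).support) J (2 ^ m * (t + 2) ^ 4) →
        ¬ PermType (mergeA (fun j => (u j).support ∪ (v j).support) J j₀)) →
      (∀ (r : ℕ) (Jc : Fin r → Finset (Fin m)) (ac bc : Fin r → Fin m → Expo),
        (∀ a ∈ tuples (fun j => (u j).support ∪ (v j).support), ∀ b ∈ tuples (fun j => (u j).support ∪ (v j).support),
          a ≠ b → ∑ j, a j = ∑ j, b j →
          ∃ k : Fin r, (∀ j, a j ≠ b j ↔ j ∈ Jc k) ∧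
            ((∀ j ∈ Jc k, a j = ac k j ∧ b j = bc k j) ∨ (∀ j ∈ Jc k, a j = bc k j ∧ b j = ac k j))) →
        2 ^ m * (t + 2) ^ 4 < 2 * (m + 1) * (3 * (2 + m + m.choose 2) ^ 2) ^ r) →
      (¬ ∃ ρp ρm : Expo →₀ ℕ, RankOneCoincidences (fun j => (u j).support ∪ (v j).support) ρp ρm) →
      (¬ ∃ L : Finset Expo, L.card ≤ C * m ∧
          R10Defs.LetterConfined (fun j => (u j).support ∪ (v j).support) L ∧
          R10Defs.FibreSpread (fun j => (u j).support ∪ (v j).support) L ((m + 2) ^ C)) →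
      ∀ (R : Expo → Expo → Prop) (S : Finset Expo), IsCellFamily u v R S → S.card ≤ 2 ^ (a * m) * (t + 2) ^ b) ↔
    ∃ a b : ℕ, ∀ (m t : ℕ), 2 ≤ t → ∀ (u v : Fin m → MvPolynomial (Fin 2) ℂ),
      (∀ j, coeff 0 (u j) = 0 ∧ (u j).support.card ≤ t) → (∀ j, coeff 0 (v j) = 0 ∧ (v j).support.card ≤ t) →
      ∀ (R : Expo → Expo → Prop) (S : Finset Expo),
        (∀ l ∈ S, ∃ ξ : Fin 2 → ℝ, ValidWeight u v ξ ∧ IsStrictTop ξ (logSupport u v) l ∧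
          ∀ e ∈ ((Finset.univ.biUnion fun j => (u j).support) ∪ Finset.univ.biUnion fun j => (v j).support),
          ∀ e' ∈ ((Finset.univ.biUnion fun j => (u j).support) ∪ Finset.univ.biUnion fun j => (v j).support),
            (R e e' ↔ wt ξ e ≤ wt ξ e')) →
        S.card ≤ 2 ^ (a * m) * (t + 2) ^ b :=
  ⟨planarCellBound_of_residualV22, fun ⟨a, b, h⟩ => ⟨0, a, b, fun m t ht u v hu hv _ _ _ _ R S hS => h m t ht u v hu hv R S hS⟩⟩

end Summit.ValiantsHypothesis.Theorems.TwoProducts.Negative.ResidualV22
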